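import Literature.NumberTheory.GaloisRepresentations.LocalKroneckerWeberInertiaProofs
import Literature.NumberTheory.GaloisRepresentations.LocalFieldPadicProofs
import HarnessLib

/-!
# X11b, S29 K3 piece (T2): CHARACTERS OF `Γ_{ℚ_p}` ON INERTIA FACTOR THROUGH THE CYCLOTOMIC CHARACTER

HONEST FRAMING (cell `b2b-bsdres`, run/shared/lean/b2b/bsd-rank1-residual/, verbatim in every
file): the goal of the cell is to DELETE the COMBINATION-SHAPED residual classes of the
Birch–Swinnerton-Dyer formula for ALL analytic-rank `≤ 1` elliptic curves over `ℚ` — assembled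
STRICTLY from published theorems — so that the rank-`≤ 1` remainder becomes exactly the
CONSTRUCTION-SHAPED classes, which are TYPED, NOT attempted. This is not "finishing BSD". Team N8/O2
(X11b at `3`: `3 ‖ N`, `r_an = 1`, `E[3]` irreducible); deal S29 (x11b3-lead GEN 8, OWNERS R9-8 /
R9-25 / R9-27), package K3, piece (T2), seat `b2b-bsdres-x11b3-p5` (gen. 6); consumer shape fixed by
`b2b-bsdres-x11b3-p1` (gen. 3), INBOX l.4871. WORDING OF RECORD (H45, R9-8): S29 RE-EXPRESSES
(t) ⟸ (VR); this file is an UNCONDITIONAL kernel lemma (local class field theory of `ℚ_p`) and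
SUPPLIES NOTHING of the class record by itself; the node `Three.HsiehDescentAt₃` is UNCHANGED; O2
OPEN / N8 CONSTRUCTION; nothing booked. THEOREMS ONLY (no definition, no named fact, no `sorry`);
valid at EVERY prime `p`.

## What this file proves

Everything is about Mathlib's `ℚ_[p]` with Mathlib's norm, Mathlib's valuative relation
`Padic.instValuativeRel` and the (Prop-valued) local-field structure of the tree,
`IsNonarchimedeanLocalField ℚ_[p]`, carried as an instance BINDER and discharged by consumers with
`haveI := Padic.isNonarchimedeanLocalField_holds p` (`LocalFieldPadicProofs.lean`); `I = absInertia
ℚ_[p] ≤ Γ_{ℚ_p} = absoluteGaloisGroup ℚ_[p]` is the tree's inertia group and `χ_p =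
GaloisRep.cyclotomicCharacter ℚ_[p] p : Γ_{ℚ_p} →* ℤ_[p]ˣ` the tree's cyclotomic character.

* §1 plumbing: `ℚ` is dense in `ℚ_[p]` (`denseRange_algebraMap`), the tree valuation and Mathlib's
  norm cut out the same unit ball (`valuation_le_one_iff`), `𝓞 ℚ → ℚ_[p]` has norm `≤ 1` and norm
  `< 1` exactly on the place `v` of `ℚ` with `primesEquiv v = p`.
* §2 **`exists_mem_absInertia_cyclotomicCharacter_eq`** — `χ_p(I_{ℚ_p}) = ℤ_pˣ`
  (`ℚ_p(μ_{p^∞})/ℚ_p` is totally ramified; Serre, *Local Fields* IV §4 Prop. 17): the tree's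
  statement `adicCompletion_rat_exists_mem_absInertia_cyclotomicCharacter_eq` for `v.adicCompletion ℚ`,
  re-run for `ℚ_[p]` (same transport of the global `exists_mem_inertia_cyclotomicCharacter_eq` along
  `exists_absGaloisRestrict_eq_of_mem_inertia`, whose engine works for any local `L` with `ℚ → L`
  dense).
* §3 **`exists_eq_comp_cyclotomicCharacter_of_mem_absInertia`** — Serre, *Local Fields* XIV §7
  Thm. 2 in inertia form for `ℚ_[p]`: a homomorphism `Λ : Γ_{ℚ_p} → M` with open kernel and
  commutative image satisfies `Λ(σ) = g(χ_p(σ) mod p^m)` on `I` for some `m ≥ 1` and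
  `g : (ℤ/p^m)ˣ → M` — the tree's proof (`LocalKroneckerWeberInertiaProofs.lean` §5, reciprocity map
  + Hopfian unit group + compactness) re-run verbatim, the only change being
  `𝒪[ℚ_[p]] ≃+* ℤ_[p]` (`Padic.nonempty_valuationInteger_ringEquiv_padicInt`) in step (7).
* The `ℤ_p`-VALUED LIMIT FORM (a continuous `a : Γ_{ℚ_p} → ℤ_p` factors through `χ_p` on `I`,
  shapes (T2-ii)) is in the sibling file `X11b/PadicInertiaCharacterLimit.lean`.

References: J.-P. Serre, *Local Fields*, GTM 67 (1979), Ch. IV §4 Prop. 17, Ch. XIV §6 Cor. 2 to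
Thm. 1, Ch. XIV §7 Thm. 2 [`SerreLocalFields1979`]; L. C. Washington, *Introduction to Cyclotomic
Fields*, GTM 83, Thm. 14.2 [`Washington1997`]; J. Neukirch, *Algebraic Number Theory*, Ch. II §9
Prop. (9.6) [`NeukirchANT1999`]. Cell files: `cells/x11b3/OWNERS.md` R9-25 / R9-27,
`HOME/b2b-bsdres-x11b3-p1/gen3/K3-INVENTORY.md` §(T2).
-/

noncomputable section

open scoped NumberField
open ValuativeRel Field IsDedekindDomain
open Literature.NumberTheory.GaloisRepresentations

namespace Summit.BirchSwinnertonDyer.Rank1Residual.X11b.PadicInertiaCharacter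

variable (p : ℕ) [Fact p.Prime]

/-! ### §1. Plumbing: `ℚ ⊂ ℚ_[p]`, the unit ball, the place `v` under `p` -/

/-- `ℚ` is dense in `ℚ_[p]` (Mathlib `Padic.denseRange_ratCast`, for the algebra map). [folklore] -/
theorem denseRange_algebraMap : DenseRange (algebraMap ℚ ℚ_[p]) := by
  have h : (algebraMap ℚ ℚ_[p] : ℚ → ℚ_[p]) = ((↑) : ℚ → ℚ_[p]) := by
    funext q; exact eq_ratCast _ q
  rw [h]
  exact _root_.Padic.denseRange_ratCast p

/-- The tree's valuation on `ℚ_[p]` (Mathlib's `Padic.instValuativeRel`) and Mathlib's norm have the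
same closed unit ball: `v x ≤ 1 ↔ ‖x‖ ≤ 1` (`Padic.mem_valuationInteger_iff`). [folklore] -/
theorem valuation_le_one_iff [IsNonarchimedeanLocalField ℚ_[p]] (x : ℚ_[p]) :
    valuation ℚ_[p] x ≤ 1 ↔ ‖x‖ ≤ 1 := by
  rw [← Valuation.mem_integer_iff]
  exact Padic.mem_valuationInteger_iff p x

/-- Every element of `𝓞 ℚ` is the cast of an integer (`Rat.IsIntegralClosure.intEquiv`).
[folklore] -/
theorem ringOfIntegers_rat_eq_intCast (r : 𝓞 ℚ) :
    r = ((Rat.IsIntegralClosure.intEquiv (𝓞 ℚ) r : ℤ) : 𝓞 ℚ) := by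
  apply (Rat.IsIntegralClosure.intEquiv (𝓞 ℚ)).injective
  rw [map_intCast, Int.cast_id]

/-- `‖r‖_p ≤ 1` for `r ∈ 𝓞 ℚ = ℤ`. [folklore] -/
theorem norm_algebraMap_ringOfIntegers_le_one (r : 𝓞 ℚ) :
    ‖algebraMap (𝓞 ℚ) ℚ_[p] r‖ ≤ 1 := by
  rw [ringOfIntegers_rat_eq_intCast r, map_intCast]
  exact _root_.Padic.norm_int_le_one _

/-- `‖r‖_p < 1 ↔ r ∈ v` for `r ∈ 𝓞 ℚ` and the place `v` of `ℚ` with `primesEquiv v = p` (i.e.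
`v = (p)`): `‖k‖_p < 1 ↔ p ∣ k` (Mathlib `Padic.norm_intCast_lt_one_iff`) and `v = (natGenerator v)`
(Mathlib `Rat.HeightOneSpectrum.span_natGenerator`). [folklore] -/
theorem norm_algebraMap_ringOfIntegers_lt_one_iff (v : HeightOneSpectrum (𝓞 ℚ))
    (hv : (Rat.HeightOneSpectrum.primesEquiv v : ℕ) = p) (r : 𝓞 ℚ) :
    ‖algebraMap (𝓞 ℚ) ℚ_[p] r‖ < 1 ↔ r ∈ v.asIdeal := by
  rw [ringOfIntegers_rat_eq_intCast r, map_intCast, _root_.Padic.norm_intCast_lt_one_iff,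
    ← Ideal.apply_mem_of_equiv_iff (f := Rat.IsIntegralClosure.intEquiv (𝓞 ℚ)), map_intCast,
    Int.cast_id, ← Rat.HeightOneSpectrum.span_natGenerator, Ideal.mem_span_singleton]
  have hgen : (Rat.HeightOneSpectrum.natGenerator v : ℤ) = p := by
    rw [← hv]; rfl
  rw [hgen]

/-- `‖·‖_p` takes a value in `(0, 1)` on `ℚ` (at `p`). [folklore] -/
theorem exists_norm_algebraMap_lt_one :
    ∃ k : ℚ, 0 < ‖algebraMap ℚ ℚ_[p] k‖ ∧ ‖algebraMap ℚ ℚ_[p] k‖ < 1 := by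
  refine ⟨p, ?_, ?_⟩
  · rw [map_natCast, norm_pos_iff]
    exact_mod_cast (Fact.out : p.Prime).ne_zero
  · rw [map_natCast]
    exact _root_.Padic.norm_p_lt_one

/-! ### §2. `χ_p(I_{ℚ_p}) = ℤ_pˣ` -/

/-- **`ℚ_p(μ_{p^∞})/ℚ_p` is totally ramified: `χ_p(I_{ℚ_p}) = ℤ_pˣ`**, for Mathlib's `ℚ_[p]` with
the tree's (Prop-valued) local-field structure `IsNonarchimedeanLocalField ℚ_[p]`
(`Padic.isNonarchimedeanLocalField_holds p`): every `u ∈ ℤ_pˣ` is the `p`-adic cyclotomic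
character of some element of the inertia group `I_{ℚ_p} = absInertia ℚ_[p] ≤ Γ_{ℚ_p}`.
Transported from the tree's global statement `exists_mem_inertia_cyclotomicCharacter_eq`
(`χ_p(I_𝔓) = ℤ_pˣ` for a prime `𝔓 ∣ p` of `\bar ℤ`) along `I_{𝔓₀} ⊆ res (I_{ℚ_p})`
(`exists_absGaloisRestrict_eq_of_mem_inertia`, `ℚ ⊂ ℚ_[p]` dense) and `χ_p ∘ res = χ_p`
(`cyclotomicCharacter_absGaloisRestrict`) — word for word the tree's
`adicCompletion_rat_exists_mem_absInertia_cyclotomicCharacter_eq` with `ℚ_[p]` for `ℚ_v`.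
Ref: Serre, *Local Fields* (1979), Ch. IV §4, Prop. 17 and Remark 1.
[cite: SerreLocalFields1979, Ch. IV §4 Prop. 17] -/
theorem exists_mem_absInertia_cyclotomicCharacter_eq [IsNonarchimedeanLocalField ℚ_[p]]
    (u : ℤ_[p]ˣ) :
    ∃ σ ∈ absInertia ℚ_[p], GaloisRep.cyclotomicCharacter ℚ_[p] p σ = u := by
  set v : HeightOneSpectrum (𝓞 ℚ) := (Rat.HeightOneSpectrum.primesEquiv (R := 𝓞 ℚ)).symm
    ⟨p, Fact.out⟩ with hv_def
  have hv : (Rat.HeightOneSpectrum.primesEquiv v : ℕ) = p := by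
    rw [hv_def, Equiv.apply_symm_apply]
  have hw := valuation_le_one_iff p
  have hO := norm_algebraMap_ringOfIntegers_le_one p
  have hvlt := norm_algebraMap_ringOfIntegers_lt_one_iff p v hv
  have hd := denseRange_algebraMap p
  obtain ⟨𝔓, h𝔓⟩ := exists_ideal_forall_mem_iff_spectralNorm_lt_one ℚ ℚ_[p] hO
  have h𝔓v : 𝔓 ∈ v.primesAbove := mem_primesAbove_of_forall_mem_iff v hvlt 𝔓 h𝔓
  obtain ⟨τ, hτ, hχτ⟩ :=
    Literature.NumberTheory.EllipticCurves.exists_mem_inertia_cyclotomicCharacter_eq p hv h𝔓v u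
  obtain ⟨σ, hσ, rfl⟩ := exists_absGaloisRestrict_eq_of_mem_inertia hw hd hO
    (exists_norm_algebraMap_lt_one p) 𝔓 h𝔓
    (HeightOneSpectrum.isMaximal_of_mem_primesAbove h𝔓v) hτ
  exact ⟨σ, hσ, by rw [← hχτ, cyclotomicCharacter_absGaloisRestrict]⟩

/-! ### §3. Serre XIV §7 Thm. 2, inertia form, for `ℚ_[p]` -/

/-- **Local Kronecker–Weber at `p`, inertia form, for Mathlib's `ℚ_[p]`** (Serre, *Local Fields*,
XIV §7, Thm. 2: the field generated over `ℚ_p` by all roots of unity is the maximal abelian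
extension of `ℚ_p`; on inertia groups: `I(ℚ̄_p/ℚ_p^ab) = I_{ℚ_p} ∩ ker χ_p`).  Let
`Λ : Γ_{ℚ_p} → M` be a homomorphism with open kernel and commutative image (e.g. a continuous
character with values in a discrete group).  Then there are `m ≥ 1` and a homomorphism
`g : (ℤ/p^m)ˣ → M` with `Λ(σ) = g(χ_p(σ) mod p^m)` for every `σ` in the inertia group `I_{ℚ_p}`.
Proof as printed (loc. cit.) and EXACTLY as in the tree's
`adicCompletion_rat_exists_eq_comp_cyclotomicCharacter_of_mem_absInertia` (stated there for the
completion `ℚ_v` of `ℚ`; here for `ℚ_[p]`): with the reciprocity map `θ : ℚ_pˣ → Γ^ab`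
(`exists_isLocalReciprocityMap_holds`; `θ(U) = 𝔗 =` image of `I_{ℚ_p}`, a topological embedding on
`U = 𝒪ˣ` — XIV §6 Cor. 2 (ii)), `e = χ_p ∘ θ|_U : U → ℤ_pˣ` is a continuous homomorphism,
surjective (`exists_mem_absInertia_cyclotomicCharacter_eq`, IV §4 Prop. 17) and therefore
injective (`injective_of_surjective_of_mulEquiv_unitsInteger` with `𝒪[ℚ_[p]] ≃+* ℤ_[p]`,
`Padic.nonempty_valuationInteger_ringEquiv_padicInt`: "any surjective endomorphism of the
Noetherian module `U_p` is bijective"); by compactness of `U` the open kernel of `Λ ∘ θ|_U` then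
contains `e⁻¹(1 + p^m ℤ_p)` for some `m`, so `Λ ∘ θ|_U` factors through `e mod p^m`, and `Λ|_{I}`
through `χ_p mod p^m`.
[cite: SerreLocalFields1979, Ch. XIV §7 Thm. 2] [cite: Washington1997, Thm. 14.2] -/
theorem exists_eq_comp_cyclotomicCharacter_of_mem_absInertia [IsNonarchimedeanLocalField ℚ_[p]]
    {M : Type*} [Group M]
    (Λ : absoluteGaloisGroup ℚ_[p] →* M)
    (hopen : IsOpen ((Λ.ker : Subgroup (absoluteGaloisGroup ℚ_[p])) :
      Set (absoluteGaloisGroup ℚ_[p])))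
    (hcomm : ∀ a b, Λ a * Λ b = Λ b * Λ a) :
    ∃ m : ℕ, 0 < m ∧ ∃ g : (ZMod (p ^ m))ˣ →* M, ∀ σ ∈ absInertia ℚ_[p],
      Λ σ = g (Units.map (PadicInt.toZModPow m).toMonoidHom
        (GaloisRep.cyclotomicCharacter ℚ_[p] p σ)) := by
  classical
  -- (1) the reciprocity map and the unit group
  obtain ⟨θ, hθ⟩ := exists_isLocalReciprocityMap_holds ℚ_[p]
  set U : Subgroup ℚ_[p]ˣ :=
    (valuation ℚ_[p]).valuationSubring.unitGroup with hU_def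
  set C : Subgroup (absoluteGaloisGroup ℚ_[p]) :=
    (commutator (absoluteGaloisGroup ℚ_[p])).topologicalClosure with hC_def
  -- (2) `Λ` factors through `Γ^ab`
  have hCΛ : C ≤ Λ.ker := by
    refine Subgroup.topologicalClosure_minimal _ ?_ (Subgroup.isClosed_of_isOpen _ hopen)
    refine Subgroup.commutator_le.mpr fun a _ b _ => ?_
    rw [MonoidHom.mem_ker, commutatorElement_def, map_mul, map_mul, map_mul, map_inv, map_inv,
      hcomm a b, mul_inv_cancel_right, mul_inv_cancel]
  set Λ' : absoluteGaloisGroupAbelianization ℚ_[p] →* M :=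
    QuotientGroup.lift C Λ hCΛ with hΛ'_def
  have hΛ' : ∀ σ, Λ' (absGaloisAbProj ℚ_[p] σ) = Λ σ := fun σ => rfl
  -- (3) the cyclotomic character factors through `Γ^ab`, continuously
  set χ := GaloisRep.cyclotomicCharacter ℚ_[p] p with hχ_def
  have hCχ : C ≤ χ.toMonoidHom.ker := by
    refine Subgroup.topologicalClosure_minimal _ (Abelianization.commutator_subset_ker _) ?_
    have : ((χ.toMonoidHom.ker : Subgroup _) : Set (absoluteGaloisGroup ℚ_[p])) =
        χ ⁻¹' {1} := by
      ext σ
      exact MonoidHom.mem_ker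
    rw [this]
    exact isClosed_singleton.preimage χ.continuous
  set χ' : absoluteGaloisGroupAbelianization ℚ_[p] →* ℤ_[p]ˣ :=
    QuotientGroup.lift C χ.toMonoidHom hCχ with hχ'_def
  have hχ' : ∀ σ, χ' (absGaloisAbProj ℚ_[p] σ) = χ σ := fun σ => rfl
  have hχ'cont : Continuous χ' := by
    refine (QuotientGroup.isQuotientMap_mk C).continuous_iff.mpr ?_
    exact χ.continuous
  -- (4) `e = χ ∘ θ|_U` and `f = Λ ∘ θ|_U`
  have hιcont : Continuous fun u : U => θ (u : ℚ_[p]ˣ) := hθ.isEmbedding_unitGroup.continuous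
  set e : U →* ℤ_[p]ˣ := χ'.comp (θ.comp U.subtype) with he_def
  set f : U →* M := Λ'.comp (θ.comp U.subtype) with hf_def
  have hecont : Continuous e := hχ'cont.comp hιcont
  -- (5) inertia elements come from units
  have hTU : ∀ σ ∈ absInertia ℚ_[p], ∃ u : U,
      θ (u : ℚ_[p]ˣ) = absGaloisAbProj ℚ_[p] σ := by
    intro σ hσ
    have hmem : absGaloisAbProj ℚ_[p] σ ∈
        (absInertia ℚ_[p]).map (absGaloisAbProj ℚ_[p]) :=
      ⟨σ, hσ, rfl⟩
    rw [← hθ.map_unitGroup] at hmem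
    obtain ⟨u, hu, hu'⟩ := hmem
    exact ⟨⟨u, hu⟩, hu'⟩
  have he_apply : ∀ σ (u : U), θ (u : ℚ_[p]ˣ) = absGaloisAbProj ℚ_[p] σ →
      e u = χ σ := by
    intro σ u hu
    change χ' (θ (u : ℚ_[p]ˣ)) = χ σ
    rw [hu, hχ']
  have hf_apply : ∀ σ (u : U), θ (u : ℚ_[p]ˣ) = absGaloisAbProj ℚ_[p] σ →
      f u = Λ σ := by
    intro σ u hu
    change Λ' (θ (u : ℚ_[p]ˣ)) = Λ σ
    rw [hu, hΛ']
  -- (6) `e` is surjective (total ramification of the cyclotomic tower)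
  have hesurj : Function.Surjective e := by
    intro w
    obtain ⟨σ, hσ, hσw⟩ :=
      exists_mem_absInertia_cyclotomicCharacter_eq p w
    obtain ⟨u, hu⟩ := hTU σ hσ
    exact ⟨u, by rw [he_apply σ u hu, hσw]⟩
  -- (7) `e` is injective: `U ≅ 𝒪ˣ ≅ ℤ_pˣ` is Hopfian
  haveI : CharZero ℚ_[p] :=
    charZero_of_injective_algebraMap (algebraMap ℚ ℚ_[p]).injective
  have α : U ≃* ((valuation ℚ_[p]).integer)ˣ :=
    (valuation ℚ_[p]).valuationSubring.unitGroupMulEquiv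
  obtain ⟨β⟩ : Nonempty (ℤ_[p]ˣ ≃* ((valuation ℚ_[p]).integer)ˣ) := by
    -- `𝒪[ℚ_[p]] = {‖x‖ ≤ 1} ≃+* ℤ_[p]` (`Padic.nonempty_valuationInteger_ringEquiv_padicInt`)
    obtain ⟨e₁⟩ := Padic.nonempty_valuationInteger_ringEquiv_padicInt p
    exact ⟨(Units.mapEquiv e₁.toMulEquiv).symm⟩
  have heinj : Function.Injective e :=
    injective_of_surjective_of_mulEquiv_unitsInteger ℚ_[p] α β e hesurj
  -- (8) an open neighbourhood of `1` in `U` on which `f = 1`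
  set V : Set U := (fun u : U => θ (u : ℚ_[p]ˣ)) ⁻¹'
    ((absGaloisAbProj ℚ_[p]) '' (Λ.ker : Set (absoluteGaloisGroup ℚ_[p])))
    with hV_def
  have hVopen : IsOpen V := (QuotientGroup.isOpenMap_coe _ hopen).preimage hιcont
  have hV1 : (1 : U) ∈ V := ⟨1, Λ.ker.one_mem, by simp⟩
  have hVf : ∀ u ∈ V, f u = 1 := by
    rintro u ⟨σ, hσ, hσu⟩
    rw [hf_apply σ u hσu.symm]
    exact hσ
  -- the closed sets `K m = {u | e u ≡ 1 mod p^m}` shrink to `{1}`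
  let K : ℕ → Set U := fun m => {u | ‖((e u : ℤ_[p]ˣ) : ℤ_[p]) - 1‖ ≤ (p : ℝ) ^ (-(m : ℤ))}
  have hKanti : ∀ m, K (m + 1) ⊆ K m := fun m u hu => by
    refine le_trans (show ‖((e u : ℤ_[p]ˣ) : ℤ_[p]) - 1‖ ≤ (p : ℝ) ^ (-((m + 1 : ℕ) : ℤ)) from hu) ?_
    have hp1 : (1 : ℝ) ≤ p := by exact_mod_cast (Fact.out : p.Prime).one_lt.le
    exact zpow_le_zpow_right₀ hp1 (by push_cast; omega)
  have hKclosed : ∀ m, IsClosed (K m) := fun m =>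
    isClosed_le ((continuous_norm.comp ((Units.continuous_val.comp hecont).sub continuous_const)))
      continuous_const
  have hKone : ∀ u : U, (∀ m, u ∈ K m) → u = 1 := by
    intro u hu
    apply heinj
    rw [map_one]
    refine Units.ext ?_
    have h0 : ((e u : ℤ_[p]ˣ) : ℤ_[p]) - 1 = 0 := by
      refine PadicInt.ext_of_toZModPow.mp fun m => ?_
      rw [map_zero, ← RingHom.mem_ker, PadicInt.ker_toZModPow,
        ← PadicInt.norm_le_pow_iff_mem_span_pow]
      exact hu m
    rw [Units.val_one]
    exact sub_eq_zero.mp h0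
  obtain ⟨m, hm⟩ : ∃ m, K m ⊆ V := by
    by_contra hcon
    have hcon' : ∀ m, ¬ K m ⊆ V := fun m h => hcon ⟨m, h⟩
    haveI : CompactSpace U := isCompact_iff_compactSpace.mp (isCompact_unitGroup ℚ_[p])
    have hne : ∀ m, (K m ∩ Vᶜ).Nonempty := fun m => by
      obtain ⟨u, hu, huV⟩ := Set.not_subset.mp (hcon' m)
      exact ⟨u, hu, huV⟩
    obtain ⟨u, hu⟩ := IsCompact.nonempty_iInter_of_sequence_nonempty_isCompact_isClosed
      (fun m => K m ∩ Vᶜ) (fun m => Set.inter_subset_inter_left _ (hKanti m)) hne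
      ((hKclosed 0).inter hVopen.isClosed_compl).isCompact
      (fun m => (hKclosed m).inter hVopen.isClosed_compl)
    have hu' := Set.mem_iInter.mp hu
    have h1 : u = 1 := hKone u fun m => (hu' m).1
    exact (hu' 0).2 (h1 ▸ hV1)
  -- (9) `f` factors through `e mod p^(m+1)`
  set π : ℤ_[p]ˣ →* (ZMod (p ^ (m + 1)))ˣ := Units.map (PadicInt.toZModPow (m + 1)).toMonoidHom
    with hπ_def
  have hπe_surj : Function.Surjective (π.comp e) :=
    (PadicInt.unitsMap_toZModPow_surjective p m.succ_pos).comp hesurj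
  have hker : (π.comp e).ker ≤ f.ker := by
    intro u hu
    rw [MonoidHom.mem_ker] at hu ⊢
    refine hVf u (hm (hKanti m ?_))
    change ‖((e u : ℤ_[p]ˣ) : ℤ_[p]) - 1‖ ≤ (p : ℝ) ^ (-((m + 1 : ℕ) : ℤ))
    rw [PadicInt.norm_le_pow_iff_mem_span_pow, ← PadicInt.ker_toZModPow, RingHom.mem_ker, map_sub,
      map_one, sub_eq_zero]
    have := congrArg (fun x : (ZMod (p ^ (m + 1)))ˣ => (x : ZMod (p ^ (m + 1)))) hu
    simpa [hπ_def] using this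
  refine ⟨m + 1, m.succ_pos, MonoidHom.liftOfSurjective (π.comp e) hπe_surj ⟨f, hker⟩, ?_⟩
  intro σ hσ
  obtain ⟨u, hu⟩ := hTU σ hσ
  rw [← hf_apply σ u hu, ← he_apply σ u hu]
  exact (MonoidHom.liftOfRightInverse_comp_apply (π.comp e) _ _ ⟨f, hker⟩ u).symm

end Summit.BirchSwinnertonDyer.Rank1Residual.X11b.PadicInertiaCharacter
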